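import Literature.AlgebraicGeometry.Frobenioids.DivisorMonoidIsoDivFrobTrivial
import Literature.AlgebraicGeometry.Frobenioids.DivisorMonoidTransportWeak
import Literature.AlgebraicGeometry.Frobenioids.Thm42iiiWeak
import Literature.AlgebraicGeometry.Frobenioids.PrimaryStepsTransportWeak
import Literature.AlgebraicGeometry.Frobenioids.Thm42SubWeak
import HarnessLib

/-!
# [FrdI] Thm. 4.9, p. 89 ll. 15–33: the isomorphism of monoids `Φ₁(A) ≅ Φ₂(Ψ A)` at a Div-Frobenius-trivial
# object, WEAKLY perf-factorial divisor monoids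

Mochizuki, *The geometry of Frobenioids I: the general theory*, Kyushu J. Math. **62** (2008)
293–400, §4, proof of Theorem 4.9 (Kyushu text p. 370) [cite: MochizukiFrdI2008, Thm. 4.9 p.89]: "… `Ψ^Prime`
extends … to an isomorphism of monoids `Φ₁^pf(A₁)_𝔭₁ ≅ Φ₂^pf(A₂)_𝔭₂` … an isomorphism of monoids
`Φ₁^pf(A₁)_factor ≅ Φ₂^pf(A₂)_factor` … maps the subset `Φ₁(A₁)` onto the subset `Φ₂(A₂)`".

PROOF-ONLY file (cell abc-iut, layer L1, seat abc-iut-L1-t14; row «C411iii/iv-WEAK» = the [FrdI] Thm. 4.9 /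
Cor. 4.11 (iii)(iv) chain over `IsPerfFactorialWeak`, block (T3)). WEAK-HYPOTHESIS TWINS of the three
`T42.Setting`-typed theorems of `DivisorMonoidIsoDivFrobTrivial.lean` (seat abc-iut-w4-d099), now over
`FrdI.T42.SettingWeak` (`Thm42SubWeak.lean`; "`Φ_i` perf-factorial" weakened to "`Φ_i` weakly perf-factorial",
Def. 2.4 (i) (a)(b)(c) + (d_ord) + (d_res); cell finding F-L2d2-1):
`SettingWeak.exists_mulEquiv_div_map_of_primes`, `…_of_isDivFrobeniusTrivial`, `…_of_isUniversallyDivFrobeniusTrivial`.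
Inputs BY NAME: `PreFrobenioid.exists_mulEquiv_div_map_weak` (`DivisorMonoidTransportWeak.lean`, seat
abc-iut-L1-t11), `PreFrobenioid.exists_rightIso_weak` (`Thm42iiiWeak.lean`, seat abc-iut-L1-t12),
`PreFrobenioid.existsUnique_primesEquiv_family_weak` (`PrimaryStepsTransportWeak.lean`, seat abc-iut-L1-t11).
Proofs verbatim. No new definitions; nothing of the paper restated or strengthened; nothing here is specific to
the abc programme and no side is taken on [IUTchIII] Cor. 3.12.
-/

namespace Literature.AlgebraicGeometry.Frobenioids

open CategoryTheory Opposite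

namespace FrdI.T42

universe w v v' u u'

variable {D₁ : Type u} [Category.{v} D₁] {Φ₁ : D₁ᵒᵖ ⥤ CommMonCat.{w}} {C₁ : Type u'} [Category.{v'} C₁]
  {D₂ : Type u} [Category.{v} D₂] {Φ₂ : D₂ᵒᵖ ⥤ CommMonCat.{w}} {C₂ : Type u'} [Category.{v'} C₂]
  {F₁ : C₁ ⥤ ElemFrobenioid Φ₁} {F₂ : C₂ ⥤ ElemFrobenioid Φ₂} {Ψ : C₁ ≌ C₂}

/-- (WEAK setting: `T42.SettingWeak`, weakly perf-factorial `Φ_i`; twin of the strong lemma of the same name without `_weak`.) **The monoid isomorphism at a Div-Frobenius-trivial object, given the prime correspondence**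
(p. 89 ll. 15–33 with Thm. 4.2 (iii), p. 81 ll. 32–58): in a `T42.SettingWeak`, if `A` is
Div-Frobenius-trivial, `Ψ` preserves the Div-identity endomorphisms of `A`, and every prime `𝔭` of
`Φ₁(A)` has a partner `𝔭'` of `Φ₂(Ψ A)` with `Div φ ∈ 𝔭 ↔ Div(Ψ φ) ∈ 𝔭'` for co-angular pre-steps `φ`
out of `A` [clause (a) of `Ψ^Prime(A)`], then there is an isomorphism of monoids
`m : Φ₁(A) ≃* Φ₂(Ψ A)` with `m(Div φ) = Div(Ψ φ)` for every pre-step `φ` out of `A`.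
[cite: MochizukiFrdI2008, Thm. 4.9 p.89] -/
theorem SettingWeak.exists_mulEquiv_div_map_of_primes (S : SettingWeak F₁ F₂ Ψ) {A : C₁}
    (hA : PreFrobenioid.IsDivFrobeniusTrivial F₁ A)
    (hdivid : ∀ α : A ⟶ A, PreFrobenioid.IsDivIdentity F₁ α →
      PreFrobenioid.IsDivIdentity F₂ (Ψ.functor.map α))
    (he : ∀ 𝔭 : Primes (Φ₁.obj (op (PreFrobenioid.baseObj F₁ A))),
      ∃ 𝔭' : Primes (Φ₂.obj (op (PreFrobenioid.baseObj F₂ (Ψ.functor.obj A)))),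
        ∀ ⦃B : C₁⦄ (φ : A ⟶ B), PreFrobenioid.IsCoAngularPreStep F₁ φ →
          (PreFrobenioid.Div F₁ φ ∈ 𝔭.submonoid ↔
            PreFrobenioid.Div F₂ (Ψ.functor.map φ) ∈ 𝔭'.submonoid)) :
    ∃ m : Φ₁.obj (op (PreFrobenioid.baseObj F₁ A)) ≃*
        Φ₂.obj (op (PreFrobenioid.baseObj F₂ (Ψ.functor.obj A))),
      ∀ ⦃B : C₁⦄ (φ : A ⟶ B), PreFrobenioid.IsPreStep F₁ φ →
        m (PreFrobenioid.Div F₁ φ) = PreFrobenioid.Div F₂ (Ψ.functor.map φ) := by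
  refine PreFrobenioid.exists_mulEquiv_div_map_weak Ψ S.isFrobenioid₁ S.isFrobenioid₂ S.perfect₁
    S.perfect₂ S.isotropic₁ S.isotropic₂ S.perfFactorial₁ S.perfFactorial₂ S.preStep_map
    S.preStep_inv A fun 𝔭 => ?_
  obtain ⟨𝔭', h𝔭'⟩ := he 𝔭
  obtain ⟨r, hr⟩ := PreFrobenioid.exists_rightIso_weak Ψ S.isFrobenioid₁ S.isFrobenioid₂ S.isotropic₁
    S.isotropic₂ S.perfFactorial₁ S.perfFactorial₂ S.preStep_map S.preStep_inv S.frobeniusType_map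
    S.degFr_map hA hdivid 𝔭 𝔭' h𝔭'
  exact ⟨𝔭', r, hr⟩

/-- (WEAK setting: `T42.SettingWeak`, weakly perf-factorial `Φ_i`; twin of the strong lemma of the same name without `_weak`.) **The monoid isomorphism `Φ₁(A) ≅ Φ₂(Ψ A)` at a Div-Frobenius-trivial object** (p. 89
ll. 15–33): in a `T42.SettingWeak` in which `Ψ` preserves and reflects primary pre-steps (Thm. 4.2 (i)),
for every Div-Frobenius-trivial `A` whose Div-identity endomorphisms are preserved by `Ψ`
(Thm. 4.2, p. 81 l. 5) there is an isomorphism of monoids `m : Φ₁(A) ≃* Φ₂(Ψ A)` computing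
`m(Div φ) = Div(Ψ φ)` for every pre-step `φ : A → B` — the prime correspondence is `Ψ^Prime(A)` of
Thm. 4.2 (ii). [cite: MochizukiFrdI2008, Thm. 4.9 p.89] -/
theorem SettingWeak.exists_mulEquiv_div_map_of_isDivFrobeniusTrivial (S : SettingWeak F₁ F₂ Ψ)
    (hprim : ∀ ⦃X Y : C₁⦄ (φ : X ⟶ Y), PreFrobenioid.IsPrimaryPreStep F₁ φ →
      PreFrobenioid.IsPrimaryPreStep F₂ (Ψ.functor.map φ))
    (hprim' : ∀ ⦃X Y : C₂⦄ (φ : X ⟶ Y), PreFrobenioid.IsPrimaryPreStep F₂ φ →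
      PreFrobenioid.IsPrimaryPreStep F₁ (Ψ.inverse.map φ))
    {A : C₁} (hA : PreFrobenioid.IsDivFrobeniusTrivial F₁ A)
    (hdivid : ∀ α : A ⟶ A, PreFrobenioid.IsDivIdentity F₁ α →
      PreFrobenioid.IsDivIdentity F₂ (Ψ.functor.map α)) :
    ∃ m : Φ₁.obj (op (PreFrobenioid.baseObj F₁ A)) ≃*
        Φ₂.obj (op (PreFrobenioid.baseObj F₂ (Ψ.functor.obj A))),
      ∀ ⦃B : C₁⦄ (φ : A ⟶ B), PreFrobenioid.IsPreStep F₁ φ →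
        m (PreFrobenioid.Div F₁ φ) = PreFrobenioid.Div F₂ (Ψ.functor.map φ) := by
  obtain ⟨e, he⟩ := (PreFrobenioid.existsUnique_primesEquiv_family_weak Ψ S.isFrobenioid₁ S.isFrobenioid₂
    S.perfect₁ S.perfect₂ S.isotropic₁ S.isotropic₂ S.perfFactorial₁ S.perfFactorial₂ S.step_map
    S.step_inv S.preStep_map S.preStep_inv hprim hprim').exists
  exact S.exists_mulEquiv_div_map_of_primes hA hdivid fun 𝔭 => ⟨e A 𝔭, (he A 𝔭).1⟩

/-- The same at a **universally** Div-Frobenius-trivial object (Def. 1.2 (iv); such an object is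
Div-Frobenius-trivial, the identity being a pull-back morphism). [cite: MochizukiFrdI2008, Thm. 4.9 p.89] -/
theorem SettingWeak.exists_mulEquiv_div_map_of_isUniversallyDivFrobeniusTrivial (S : SettingWeak F₁ F₂ Ψ)
    (hprim : ∀ ⦃X Y : C₁⦄ (φ : X ⟶ Y), PreFrobenioid.IsPrimaryPreStep F₁ φ →
      PreFrobenioid.IsPrimaryPreStep F₂ (Ψ.functor.map φ))
    (hprim' : ∀ ⦃X Y : C₂⦄ (φ : X ⟶ Y), PreFrobenioid.IsPrimaryPreStep F₂ φ →
      PreFrobenioid.IsPrimaryPreStep F₁ (Ψ.inverse.map φ))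
    {A : C₁} (hA : PreFrobenioid.IsUniversallyDivFrobeniusTrivial F₁ A)
    (hdivid : ∀ α : A ⟶ A, PreFrobenioid.IsDivIdentity F₁ α →
      PreFrobenioid.IsDivIdentity F₂ (Ψ.functor.map α)) :
    ∃ m : Φ₁.obj (op (PreFrobenioid.baseObj F₁ A)) ≃*
        Φ₂.obj (op (PreFrobenioid.baseObj F₂ (Ψ.functor.obj A))),
      ∀ ⦃B : C₁⦄ (φ : A ⟶ B), PreFrobenioid.IsPreStep F₁ φ →
        m (PreFrobenioid.Div F₁ φ) = PreFrobenioid.Div F₂ (Ψ.functor.map φ) :=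
  S.exists_mulEquiv_div_map_of_isDivFrobeniusTrivial hprim hprim' hA.isDivFrobeniusTrivial hdivid

end FrdI.T42

end Literature.AlgebraicGeometry.Frobenioids
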